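import Summits.QuantumFields.YangMills.Theorems.CovariantDischargeSweepSimultaneous
import Summits.QuantumFields.YangMills.Theorems.CovariantDischargeUniformFluxLetters
import Literature.MathematicalPhysics.QuantumFieldTheory.Balaban1983to89.B15Prop1ChartCalculusSU2
import HarnessLib

/-!
# Line «sandwich_discharge» on crux `HistoryTailL` (stmt-QuantumFields-19936), stub `stub_sandwichSweepGapCapped` — B2″:
# A COVARIANTLY FRAMED ONE-AXIS SWEEP IS INVARIANT UNDER ITS OWN STEPS, hence is the simultaneous left product WITHOUT re-gauging the amplitude

Cell `ym3-torus` (YM ladder rung R3 = continuum SU(2) Yang–Mills on the three-torus — a RUNG, NOT the Clay problem: not d = 4, not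
infinite volume, not a mass gap), width seat `ym-ust-19936-w5` gen 14, helper letters `--supports stmt-QuantumFields-19936`.
WHY.  B2′ (✓`CovariantDischargeSweepSimultaneous.exists_sweep_pair`) needs `hread`: no direction field reads ANY swept link; ARCH-S′ §2
meets it by re-gauging the amplitude to vanish on the frame tree — but the tree∕axial representative of a compactly supported exact
amplitude is NOT compactly supported (flux shadows of `da` along the comb directions), and truncating the gauge function at the ball
boundary leaves swept links whose outer endpoints have no unswept path to the centre (this seat's LOCATE, 19936 evidence #58).  REPAIR:
no re-gauging.  A framed step `U_{b′} ↦ expPoint(c·Ad_{G_{b′}(U)} n̂₀)·U_{b′}` on a link of the frame path `P = A·g^{±1}·B` multiplies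
`P` on the LEFT by `expPoint(±c·n̂₀)` (§2), rotations about `n̂₀` fix `n̂₀`, so every downstream frame `Ad_{P⁻¹} n̂₀` — hence every
direction — is EXACTLY unchanged; and §1 shows that this STEP-INVARIANCE is all that B2′'s conclusions need.
* §1 (generic `G`): ★`dir_simultaneous_eq_of_stepInvariant`, ★`foldr_sweep_eq_simultaneous_of_stepInvariant`,
  `measurePreserving_simultaneous_of_stepInvariant` (own-link independence `hself`) ∕ `…_of_haar` (per-step Haar invariance as a
  hypothesis, so LEFT steps and — for a link its own frame path traverses backwards — RIGHT steps `measurePreserving_step_of_eq_mul_right`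
  mix), `leftInverse_…`∕`rightInverse_…`, ★★`exists_sweep_pair_of_stepInvariant` ∕ `…_of_haar` — B2′'s four-clause package, same `Ψ′`,
  under `hstep`∕`hstepInv` INSTEAD of `hread`.
* §2 (`SU(2)`): `adSU2_expPoint_smul_self`, the forward∕backward insertions `mul_expPoint_smul_adSU2_inv_mul` ∕ `mul_inv_expPoint_smul_adSU2_mul`,
  ★`adSU2_inv_expPoint_smul_mul`, ★★`expPoint_smul_adSU2_inv_framedStep`, `…_eq_of_cases`.
* §3 (`SU(2)`, ANY prefix-closed transport `Pt y U`): ★★`framedDir_update_eq` ∕ `framedDir_update_inv_eq` — the three tree alternatives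
  (not read ∕ forward ∕ backward) give `hstep`∕`hstepInv` pointwise; `framedStep_mul_eq_mul_conj` (own-link backward case = right translation).
WHAT THIS IS NOT.  No tree or comb is constructed (the path dictionary «`Pt y = A·g^{±1}·B` when the path traverses `g`» is the consumer's,
over lit `B7Prop1Explicit.treeWord`∕`T4AxialGaugeSmallField.axialGauge`); no profile, no action estimate; nothing of
`stub_sandwichSweepGapCapped`, `HistoryTailL`, the rung R3, d = 4, a continuum limit or a mass gap is proved.  YM₃ on T³ is rung R3, NOT Clay.
References: T. Bałaban, CMP **98** (1985) 17–51 [Balaban1985Averaging] ((8)–(10) p.19; pp.24–25 the axial gauge along `Γ_{y,x}`);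
CMP **122** (1989) 175–202 [Balaban1989LargeFieldI] ((1.77) p.194 the adjoint action).  Elementary ([folklore]).
-/
noncomputable section

open MeasureTheory

namespace Summit.QuantumFields.YangMills.Theorems.CovariantDischargeFramedSweepInvariance

open Literature.MathematicalPhysics.QuantumFieldTheory.Balaban1983to89
open Summit.QuantumFields.YangMills.Theorems.CovariantDischargeHaarSweepReweighting
  (measurePreserving_update_mul_left measurePreserving_update_mul_right measurePreserving_foldr_comp)
open Summit.QuantumFields.YangMills.Theorems.CovariantDischargeSweepSimultaneous (measurable_simultaneous_inv)

/-! ## §1 Generic gauge group: step-invariant direction fields sweep as the simultaneous product -/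

section Generic

variable {P : Params} {j : ℕ} {G : Type*} [GaugeGroup G] [DecidableEq (PBond P j)]

variable (n m : PBond P j → GaugeField P j G → G)

omit [GaugeGroup G] in
/-- ★ **DIRECTIONS READ ON A SIMULTANEOUS PRODUCT OF INVARIANT STEPS EQUAL DIRECTIONS READ ON THE ORIGINAL FIELD.**  If the direction
fields `n_b` and the multiplier fields `m_b` (`b ∈ S`) are both invariant under every single step `U ↦ U[b′ ↦ m_{b′}(U)·U_{b′}]`, `b′ ∈ S`,
then for every duplicate-free list `l ⊆ S`, `n_{b₀}((b ↦ if b ∈ l then m_b(U)·U_b else U_b)) = n_{b₀}(U)`. [folklore] -/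
theorem dir_simultaneous_eq_of_stepInvariant [Group G] {S : Finset (PBond P j)}
    (hmn : ∀ (b b' : PBond P j) (U : GaugeField P j G), b ∈ S → b' ∈ S →
      n b (Function.update U b' (m b' U * U b')) = n b U)
    (hmm : ∀ (b b' : PBond P j) (U : GaugeField P j G), b ∈ S → b' ∈ S →
      m b (Function.update U b' (m b' U * U b')) = m b U) :
    ∀ (l : List (PBond P j)), l.Nodup → (∀ b ∈ l, b ∈ S) → ∀ (b₀ : PBond P j), b₀ ∈ S → ∀ (U : GaugeField P j G),
      n b₀ (fun b => if b ∈ l then m b U * U b else U b) = n b₀ U ∧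
        m b₀ (fun b => if b ∈ l then m b U * U b else U b) = m b₀ U
  | [], _, _, b₀, _, U => by
    have : (fun b => if b ∈ ([] : List (PBond P j)) then m b U * U b else U b) = U := by
      funext b; rw [if_neg (List.not_mem_nil)]
    rw [this]; exact ⟨rfl, rfl⟩
  | b₁ :: l, hnd, hlS, b₀, hb₀, U => by
    have hnd' : l.Nodup := (List.nodup_cons.mp hnd).2
    have hb₁l : b₁ ∉ l := (List.nodup_cons.mp hnd).1
    have hlS' : ∀ b ∈ l, b ∈ S := fun b hb => hlS b (List.mem_cons_of_mem b₁ hb)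
    have hb₁S : b₁ ∈ S := hlS b₁ List.mem_cons_self
    have IH := dir_simultaneous_eq_of_stepInvariant hmn hmm l hnd' hlS'
    set W : GaugeField P j G := fun b => if b ∈ l then m b U * U b else U b with hW
    have key : (fun b => if b ∈ b₁ :: l then m b U * U b else U b) = Function.update W b₁ (m b₁ W * W b₁) := by
      funext b
      by_cases hb : b = b₁
      · subst hb
        rw [Function.update_self, (IH b hb₁S U).2]
        simp [hW, hb₁l]
      · rw [Function.update_of_ne hb]
        simp [hW, List.mem_cons, hb]
    rw [key]
    exact ⟨(hmn b₀ b₁ W hb₀ hb₁S).trans (IH b₀ hb₀ U).1, (hmm b₀ b₁ W hb₀ hb₁S).trans (IH b₀ hb₀ U).2⟩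

/-- ★ **A STEP-INVARIANT SWEEP IS THE SIMULTANEOUS LEFT PRODUCT.**  For a duplicate-free list `l ⊆ S` and direction fields `n_b`
invariant under the steps `U ↦ U[b′ ↦ n_{b′}(U)·U_{b′}]` (`b, b′ ∈ S`), the composition (`foldr`) of the single-link translations
`U ↦ U[b ↦ n_b(U)·U_b]`, `b ∈ l`, equals `U ↦ (b ↦ if b ∈ l then n_b(U)·U_b else U_b)`. [folklore] -/
theorem foldr_sweep_eq_simultaneous_of_stepInvariant {S : Finset (PBond P j)}
    (hstep : ∀ (b b' : PBond P j) (U : GaugeField P j G), b ∈ S → b' ∈ S →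
      n b (Function.update U b' (n b' U * U b')) = n b U) :
    ∀ (l : List (PBond P j)), l.Nodup → (∀ b ∈ l, b ∈ S) →
      (l.map fun b => fun U : GaugeField P j G => Function.update U b (n b U * U b)).foldr (· ∘ ·) id =
        fun U b => if b ∈ l then n b U * U b else U b
  | [], _, _ => by
    funext U b
    rw [if_neg (List.not_mem_nil)]
    rfl
  | b₀ :: l, hnd, hlS => by
    have hnd' : l.Nodup := (List.nodup_cons.mp hnd).2
    have hb₀l : b₀ ∉ l := (List.nodup_cons.mp hnd).1
    have hlS' : ∀ b ∈ l, b ∈ S := fun b hb => hlS b (List.mem_cons_of_mem b₀ hb)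
    have hb₀S : b₀ ∈ S := hlS b₀ List.mem_cons_self
    have IH := foldr_sweep_eq_simultaneous_of_stepInvariant hstep l hnd' hlS'
    show ((fun U : GaugeField P j G => Function.update U b₀ (n b₀ U * U b₀)) ∘
        (l.map fun b => fun U : GaugeField P j G => Function.update U b (n b U * U b)).foldr (· ∘ ·) id) = _
    rw [IH]
    funext U b
    simp only [Function.comp_apply]
    have hdir : n b₀ (fun b => if b ∈ l then n b U * U b else U b) = n b₀ U :=
      ((dir_simultaneous_eq_of_stepInvariant n n hstep hstep l hnd' hlS' b₀ hb₀S U)).1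
    by_cases hb : b = b₀
    · subst hb
      simp [hb₀l, hdir]
    · rw [Function.update_of_ne hb]
      by_cases hbl : b ∈ l
      · simp [hbl, List.mem_cons, hb]
      · simp [hbl, List.mem_cons, hb]

variable [MeasurableSpace G] [HaarData G] [MeasurableMul₂ G]

/-- **THE SIMULTANEOUS PRODUCT PRESERVES `dU`** under step-invariance and own-link independence (`n_b` does not read `U_b`).
[cite: Balaban1985Averaging, (10) p.19] -/
theorem measurePreserving_simultaneous_of_stepInvariant {S : Finset (PBond P j)} (hn : ∀ b, Measurable (n b))
    (hself : ∀ (b : PBond P j) (U : GaugeField P j G) (g : G), b ∈ S → n b (Function.update U b g) = n b U)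
    (hstep : ∀ (b b' : PBond P j) (U : GaugeField P j G), b ∈ S → b' ∈ S →
      n b (Function.update U b' (n b' U * U b')) = n b U)
    (l : List (PBond P j)) (hnd : l.Nodup) (hlS : ∀ b ∈ l, b ∈ S) :
    MeasurePreserving (fun (U : GaugeField P j G) (b : PBond P j) => if b ∈ l then n b U * U b else U b)
      (fieldMeasure P j G) (fieldMeasure P j G) := by
  rw [← foldr_sweep_eq_simultaneous_of_stepInvariant n hstep l hnd hlS]
  refine measurePreserving_foldr_comp _ fun Ψ hΨ => ?_
  obtain ⟨b, hb, rfl⟩ := List.mem_map.mp hΨ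
  exact measurePreserving_update_mul_left b (hn b) fun U g => hself b U g (hlS b hb)

omit [MeasurableMul₂ G] in
/-- The same with the Haar invariance of each single step as a HYPOTHESIS (`hhaar`), so that steps of either kind can be mixed: LEFT
translations by a `U_b`-independent element (✓`measurePreserving_update_mul_left`) and — for a link that its own frame path traverses
backwards, where `n_b(U) = U_b·K(U)·U_b⁻¹` — RIGHT translations `U_b ↦ U_b·K(U)` (`measurePreserving_step_of_eq_mul_right` below).
[cite: Balaban1985Averaging, (10) p.19] -/
theorem measurePreserving_simultaneous_of_stepInvariant_of_haar {S : Finset (PBond P j)}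
    (hhaar : ∀ b ∈ S, MeasurePreserving (fun U : GaugeField P j G => Function.update U b (n b U * U b))
      (fieldMeasure P j G) (fieldMeasure P j G))
    (hstep : ∀ (b b' : PBond P j) (U : GaugeField P j G), b ∈ S → b' ∈ S →
      n b (Function.update U b' (n b' U * U b')) = n b U)
    (l : List (PBond P j)) (hnd : l.Nodup) (hlS : ∀ b ∈ l, b ∈ S) :
    MeasurePreserving (fun (U : GaugeField P j G) (b : PBond P j) => if b ∈ l then n b U * U b else U b)
      (fieldMeasure P j G) (fieldMeasure P j G) := by
  rw [← foldr_sweep_eq_simultaneous_of_stepInvariant n hstep l hnd hlS]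
  refine measurePreserving_foldr_comp _ fun Ψ hΨ => ?_
  obtain ⟨b, hb, rfl⟩ := List.mem_map.mp hΨ
  exact hhaar b (hlS b hb)

/-- **A CONJUGATED STEP IS A RIGHT TRANSLATION**: if `n_b(U)·U_b = U_b·K(U)` with `K` measurable and not reading `U_b` (the case of a link
traversed BACKWARDS by its own frame path: `n_b(U) = U_b·K(U)·U_b⁻¹`), the step `U ↦ U[b ↦ n_b(U)·U_b]` preserves `dU` by RIGHT invariance
of Haar measure (✓`measurePreserving_update_mul_right`). [cite: Balaban1985Averaging, (10) p.19] -/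
theorem measurePreserving_step_of_eq_mul_right (b : PBond P j) {K : GaugeField P j G → G} (hK : Measurable K)
    (hKb : ∀ (U : GaugeField P j G) (g : G), K (Function.update U b g) = K U)
    (hnK : ∀ U : GaugeField P j G, n b U * U b = U b * K U) :
    MeasurePreserving (fun U : GaugeField P j G => Function.update U b (n b U * U b))
      (fieldMeasure P j G) (fieldMeasure P j G) := by
  have e : (fun U : GaugeField P j G => Function.update U b (n b U * U b)) =
      fun U : GaugeField P j G => Function.update U b (U b * K U) := by
    funext U; rw [hnK U]
  rw [e]
  exact measurePreserving_update_mul_right b hK hKb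

variable [MeasurableInv G]

omit [MeasurableSpace G] [HaarData G] [MeasurableMul₂ G] [MeasurableInv G] in
/-- The inverse-direction product undoes the simultaneous product (directions read on the swept field equal directions read on the
original, by step-invariance). [folklore] -/
theorem leftInverse_simultaneous_of_stepInvariant {S : Finset (PBond P j)}
    (hstep : ∀ (b b' : PBond P j) (U : GaugeField P j G), b ∈ S → b' ∈ S →
      n b (Function.update U b' (n b' U * U b')) = n b U)
    (l : List (PBond P j)) (hnd : l.Nodup) (hlS : ∀ b ∈ l, b ∈ S) :
    Function.LeftInverse (fun (U : GaugeField P j G) (b : PBond P j) => if b ∈ l then (n b U)⁻¹ * U b else U b)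
      (fun (U : GaugeField P j G) (b : PBond P j) => if b ∈ l then n b U * U b else U b) := by
  intro U
  funext b
  by_cases hb : b ∈ l
  · have hdir := ((dir_simultaneous_eq_of_stepInvariant n n hstep hstep l hnd hlS b (hlS b hb) U)).1
    simp [hb, hdir]
  · simp [hb]

omit [MeasurableSpace G] [HaarData G] [MeasurableMul₂ G] [MeasurableInv G] in
/-- … and the simultaneous product undoes the inverse-direction product, under invariance of the directions along the INVERSE steps
`U ↦ U[b′ ↦ n_{b′}(U)⁻¹·U_{b′}]`. [folklore] -/
theorem rightInverse_simultaneous_of_stepInvariant {S : Finset (PBond P j)}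
    (hstepInv : ∀ (b b' : PBond P j) (U : GaugeField P j G), b ∈ S → b' ∈ S →
      n b (Function.update U b' ((n b' U)⁻¹ * U b')) = n b U)
    (l : List (PBond P j)) (hnd : l.Nodup) (hlS : ∀ b ∈ l, b ∈ S) :
    Function.RightInverse (fun (U : GaugeField P j G) (b : PBond P j) => if b ∈ l then (n b U)⁻¹ * U b else U b)
      (fun (U : GaugeField P j G) (b : PBond P j) => if b ∈ l then n b U * U b else U b) := by
  intro U
  funext b
  have hmm : ∀ (b b' : PBond P j) (U : GaugeField P j G), b ∈ S → b' ∈ S →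
      (fun b U => (n b U)⁻¹) b (Function.update U b' ((fun b U => (n b U)⁻¹) b' U * U b')) = (fun b U => (n b U)⁻¹) b U :=
    fun b b' U hb hb' => congrArg (fun x : G => x⁻¹) (hstepInv b b' U hb hb')
  by_cases hb : b ∈ l
  · have hdir := ((dir_simultaneous_eq_of_stepInvariant n (fun b U => (n b U)⁻¹) hstepInv hmm l hnd hlS b (hlS b hb) U)).1
    simp [hb, hdir]
  · simp [hb]

/-- ★★ **THE PACKAGED SWEEP PAIR UNDER STEP-INVARIANCE** (the four-clause shape of the sweep-gap stubs, `hread` of B2′ replaced by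
own-link independence + invariance along the forward and the inverse steps): `Ψ U := (b ↦ if b ∈ S then n_b(U)·U_b else U_b)` is
`dU`-preserving and `Ψ′ U := (b ↦ if b ∈ S then n_b(U)⁻¹·U_b else U_b)` is its measurable two-sided inverse. [cite: Balaban1985Averaging, (10) p.19] -/
theorem exists_sweep_pair_of_stepInvariant (S : Finset (PBond P j)) (hn : ∀ b, Measurable (n b))
    (hself : ∀ (b : PBond P j) (U : GaugeField P j G) (g : G), b ∈ S → n b (Function.update U b g) = n b U)
    (hstep : ∀ (b b' : PBond P j) (U : GaugeField P j G), b ∈ S → b' ∈ S →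
      n b (Function.update U b' (n b' U * U b')) = n b U)
    (hstepInv : ∀ (b b' : PBond P j) (U : GaugeField P j G), b ∈ S → b' ∈ S →
      n b (Function.update U b' ((n b' U)⁻¹ * U b')) = n b U) :
    ∃ Ψ Ψ' : GaugeField P j G → GaugeField P j G,
      MeasurePreserving Ψ (fieldMeasure P j G) (fieldMeasure P j G) ∧ Measurable Ψ' ∧
        Function.LeftInverse Ψ' Ψ ∧ Function.RightInverse Ψ' Ψ ∧
        (∀ U b, Ψ U b = if b ∈ S then n b U * U b else U b) ∧ (∀ U b, Ψ' U b = if b ∈ S then (n b U)⁻¹ * U b else U b) := by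
  have hmem : ∀ b, b ∈ S.toList ↔ b ∈ S := fun b => Finset.mem_toList
  refine ⟨fun U b => if b ∈ S.toList then n b U * U b else U b, fun U b => if b ∈ S.toList then (n b U)⁻¹ * U b else U b,
    measurePreserving_simultaneous_of_stepInvariant n hn hself hstep S.toList (Finset.nodup_toList S) (fun b hb => (hmem b).mp hb),
    measurable_simultaneous_inv n hn S.toList,
    leftInverse_simultaneous_of_stepInvariant n hstep S.toList (Finset.nodup_toList S) (fun b hb => (hmem b).mp hb),
    rightInverse_simultaneous_of_stepInvariant n hstepInv S.toList (Finset.nodup_toList S) (fun b hb => (hmem b).mp hb),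
    fun U b => ?_, fun U b => ?_⟩
  · simp only [hmem]
  · simp only [hmem]

/-- ★★ The packaged sweep pair with the per-step Haar invariance as a hypothesis (`hhaar`, mixing left and right translations — see
`measurePreserving_step_of_eq_mul_right`) instead of own-link independence. [cite: Balaban1985Averaging, (10) p.19] -/
theorem exists_sweep_pair_of_stepInvariant_of_haar (S : Finset (PBond P j)) (hn : ∀ b, Measurable (n b))
    (hhaar : ∀ b ∈ S, MeasurePreserving (fun U : GaugeField P j G => Function.update U b (n b U * U b))
      (fieldMeasure P j G) (fieldMeasure P j G))
    (hstep : ∀ (b b' : PBond P j) (U : GaugeField P j G), b ∈ S → b' ∈ S →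
      n b (Function.update U b' (n b' U * U b')) = n b U)
    (hstepInv : ∀ (b b' : PBond P j) (U : GaugeField P j G), b ∈ S → b' ∈ S →
      n b (Function.update U b' ((n b' U)⁻¹ * U b')) = n b U) :
    ∃ Ψ Ψ' : GaugeField P j G → GaugeField P j G,
      MeasurePreserving Ψ (fieldMeasure P j G) (fieldMeasure P j G) ∧ Measurable Ψ' ∧
        Function.LeftInverse Ψ' Ψ ∧ Function.RightInverse Ψ' Ψ ∧
        (∀ U b, Ψ U b = if b ∈ S then n b U * U b else U b) ∧ (∀ U b, Ψ' U b = if b ∈ S then (n b U)⁻¹ * U b else U b) := by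
  have hmem : ∀ b, b ∈ S.toList ↔ b ∈ S := fun b => Finset.mem_toList
  refine ⟨fun U b => if b ∈ S.toList then n b U * U b else U b, fun U b => if b ∈ S.toList then (n b U)⁻¹ * U b else U b,
    measurePreserving_simultaneous_of_stepInvariant_of_haar n hhaar hstep S.toList (Finset.nodup_toList S)
      (fun b hb => (hmem b).mp hb),
    measurable_simultaneous_inv n hn S.toList,
    leftInverse_simultaneous_of_stepInvariant n hstep S.toList (Finset.nodup_toList S) (fun b hb => (hmem b).mp hb),
    rightInverse_simultaneous_of_stepInvariant n hstepInv S.toList (Finset.nodup_toList S) (fun b hb => (hmem b).mp hb),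
    fun U b => ?_, fun U b => ?_⟩
  · simp only [hmem]
  · simp only [hmem]

end Generic

/-! ## §2 `SU(2)`: framed one-axis steps leave the downstream frames unchanged -/

section SU2Frames

open scoped Quaternion
open Literature.MathematicalPhysics.QuantumLattice (su2Quat su2Quat_ne_zero)
open Literature.MathematicalPhysics.QuantumFieldTheory.Balaban1983to89.T4CubeChartGnomonic (SU2)
open Literature.MathematicalPhysics.QuantumFieldTheory.Balaban1983to89.T4HaarSU2ExpChart
  (imQuat imQuat_injective expPoint su2Quat_expPoint exp_imQuat)
open Literature.MathematicalPhysics.QuantumFieldTheory.Balaban1983to89.B15Prop1ChartSU2 (adSU2 iexp_adSU2 su2Chart_iexp)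
open Literature.MathematicalPhysics.QuantumFieldTheory.Balaban1983to89.B15Prop1ChartCalculusSU2 (imQuat_adSU2 adSU2_adSU2)
open Summit.QuantumFields.YangMills.Theorems.CovariantDischargeUniformFluxLetters (expPoint_neg_smul)

/-- **A ROTATION FIXES ITS OWN AXIS**: `Ad_{expPoint(c•n)} n = n` (the unit quaternion `exp(ι cn) = cos + sinc·ι cn` commutes with `ι n`).
[cite: Balaban1989LargeFieldI, (1.77) p.194] -/
theorem adSU2_expPoint_smul_self (c : ℝ) (n : EuclideanSpace ℝ (Fin 3)) : adSU2 (expPoint (c • n)) n = n := by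
  apply imQuat_injective
  rw [imQuat_adSU2]
  set q : ℍ := su2Quat (expPoint (c • n)) with hq
  have hq' : q = (Real.cos ‖c • n‖ : ℍ) + Real.sinc ‖c • n‖ • imQuat (c • n) := by
    rw [hq, su2Quat_expPoint, exp_imQuat]
  have hcomm : q * imQuat n = imQuat n * q := by
    rw [hq', map_smul, smul_smul, add_mul, mul_add, Quaternion.coe_commutes, smul_mul_assoc, mul_smul_comm]
  rw [hcomm, mul_inv_cancel_right₀ (su2Quat_ne_zero _)]

/-- Ad-covariance of the one-axis translation (lit ✓`iexp_adSU2`, linearity of `Ad`): `expPoint(c • Ad_G n) = G·expPoint(c•n)·G⁻¹`. [cite: Balaban1989LargeFieldI, (1.77) p.194] -/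
private theorem expPoint_smul_adSU2' (G₀ : SU2) (c : ℝ) (n : EuclideanSpace ℝ (Fin 3)) :
    expPoint (c • adSU2 G₀ n) = G₀ * expPoint (c • n) * G₀⁻¹ := by
  rw [← LinearMap.map_smul]
  have h := iexp_adSU2 G₀ (c • n)
  simpa only [su2Chart_iexp] using h

/-- **FORWARD INSERTION**: a framed step on a link `g` traversed forward by a transport `P = A·g·B` whose prefix up to the source of
`g` is `A` multiplies `P` on the LEFT by the centre rotation: `A·(expPoint(c • Ad_{A⁻¹} n̂₀)·g)·B = expPoint(c•n̂₀)·(A·g·B)`.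
[cite: Balaban1985Averaging, (8)-(9) p.19; Balaban1989LargeFieldI, (1.77) p.194] -/
theorem mul_expPoint_smul_adSU2_inv_mul (A g B : SU2) (c : ℝ) (n : EuclideanSpace ℝ (Fin 3)) :
    A * (expPoint (c • adSU2 A⁻¹ n) * g) * B = expPoint (c • n) * (A * g * B) := by
  rw [expPoint_smul_adSU2', inv_inv]
  group

/-- **BACKWARD INSERTION**: if `P = A·g⁻¹·B` traverses `g` backwards (prefix `A` up to the target of `g`, so the frame at the source of
`g` is transported by `A·g⁻¹`), the framed step multiplies `P` on the left by the INVERSE centre rotation: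
`A·(expPoint(c • Ad_{(A g⁻¹)⁻¹} n̂₀)·g)⁻¹·B = expPoint((−c)•n̂₀)·(A·g⁻¹·B)`. [cite: Balaban1985Averaging, (8)-(9) p.19] -/
theorem mul_inv_expPoint_smul_adSU2_mul (A g B : SU2) (c : ℝ) (n : EuclideanSpace ℝ (Fin 3)) :
    A * (expPoint (c • adSU2 (A * g⁻¹)⁻¹ n) * g)⁻¹ * B = expPoint ((-c) • n) * (A * g⁻¹ * B) := by
  rw [expPoint_smul_adSU2', inv_inv, expPoint_neg_smul]
  group

/-- ★ **THE FRAME IS BLIND TO CENTRE ROTATIONS ON THE LEFT**: `Ad_{(expPoint(c•n)·P)⁻¹} n = Ad_{P⁻¹} n`. [cite: Balaban1989LargeFieldI, (1.77) p.194] -/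
theorem adSU2_inv_expPoint_smul_mul (c : ℝ) (n : EuclideanSpace ℝ (Fin 3)) (Pt : SU2) :
    adSU2 (expPoint (c • n) * Pt)⁻¹ n = adSU2 Pt⁻¹ n := by
  rw [mul_inv_rev, ← adSU2_adSU2, ← expPoint_neg_smul, adSU2_expPoint_smul_self]

/-- ★★ **FRAMED DIRECTIONS ARE INVARIANT UNDER UPSTREAM FRAMED STEPS**: if a framed step changes the transport `P` to the source of a link
into `expPoint(c•n̂₀)·P` (forward insertion) or `expPoint((−c)•n̂₀)·P` (backward insertion), the framed direction there is unchanged: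
`expPoint(c′ • Ad_{(expPoint(c•n̂₀)·P)⁻¹} n̂₀) = expPoint(c′ • Ad_{P⁻¹} n̂₀)` — the letter behind `hstep`∕`hstepInv` of §1 for tree∕comb frames.
[cite: Balaban1985Averaging, pp.24-25; Balaban1989LargeFieldI, (1.77) p.194] -/
theorem expPoint_smul_adSU2_inv_framedStep (c c' : ℝ) (n : EuclideanSpace ℝ (Fin 3)) (Pt : SU2) :
    expPoint (c' • adSU2 (expPoint (c • n) * Pt)⁻¹ n) = expPoint (c' • adSU2 Pt⁻¹ n) := by
  rw [adSU2_inv_expPoint_smul_mul]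

/-- The three tree alternatives at once: the framed direction is unchanged whenever `P′ ∈ {P, expPoint(c•n̂₀)·P, expPoint((−c)•n̂₀)·P}`.
[cite: Balaban1985Averaging, pp.24-25] -/
theorem expPoint_smul_adSU2_inv_eq_of_cases (c c' : ℝ) (n : EuclideanSpace ℝ (Fin 3)) (Pt Pt' : SU2)
    (h : Pt' = Pt ∨ Pt' = expPoint (c • n) * Pt ∨ Pt' = expPoint ((-c) • n) * Pt) :
    expPoint (c' • adSU2 Pt'⁻¹ n) = expPoint (c' • adSU2 Pt⁻¹ n) := by
  rcases h with h | h | h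
  · rw [h]
  · rw [h, adSU2_inv_expPoint_smul_mul]
  · rw [h, adSU2_inv_expPoint_smul_mul]

end SU2Frames

/-! ## §3 `SU(2)`: directions framed by ANY prefix-closed transport are step-invariant -/

section PrefixTransport

open Literature.MathematicalPhysics.QuantumFieldTheory.Balaban1983to89.T4CubeChartGnomonic (SU2)
open Literature.MathematicalPhysics.QuantumFieldTheory.Balaban1983to89.T4HaarSU2ExpChart (expPoint)
open Literature.MathematicalPhysics.QuantumFieldTheory.Balaban1983to89.B15Prop1ChartSU2 (adSU2)

variable {P : Params} {j : ℕ} [DecidableEq (PBond P j)]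

/-- ★★ **STEP-INVARIANCE OF TRANSPORT-FRAMED DIRECTIONS (abstract tree).**  Transports `Pt y U ∈ SU(2)`, framed directions
`n_b(U) := expPoint(c_b • Ad_{(Pt b.src U)⁻¹} n̂₀)`; for the swept link `b′` and the site `y` ONE of: (i) `Pt y` does not read `U_{b′}`; (ii) FORWARD
`Pt y U = Pt b′.src U · U_{b′} · B U` (`Pt b′.src`, `B` not reading `U_{b′}`); (iii) BACKWARD `Pt y U = A U · U_{b′}⁻¹ · B U`, `Pt b′.src U = A U · U_{b′}⁻¹`
(`A`, `B` not reading `U_{b′}`).  Then the framed direction at `y` (any `c′`) is unchanged by the framed step at `b′` (any `c`).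
[cite: Balaban1985Averaging, pp.24-25; Balaban1989LargeFieldI, (1.77) p.194] -/
theorem framedDir_update_eq (Pt : Site P j → GaugeField P j SU2 → SU2) (n : EuclideanSpace ℝ (Fin 3)) (b' : PBond P j) (y : Site P j)
    (U : GaugeField P j SU2) (c c' : ℝ)
    (halt : (∀ g : SU2, Pt y (Function.update U b' g) = Pt y U) ∨
      (∃ B : GaugeField P j SU2 → SU2, (∀ g : SU2, B (Function.update U b' g) = B U) ∧
        (∀ g : SU2, Pt b'.src (Function.update U b' g) = Pt b'.src U) ∧
        ∀ V : GaugeField P j SU2, (∀ b, b ≠ b' → V b = U b) → Pt y V = Pt b'.src V * V b' * B V) ∨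
      (∃ A B : GaugeField P j SU2 → SU2, (∀ g : SU2, A (Function.update U b' g) = A U) ∧ (∀ g : SU2, B (Function.update U b' g) = B U) ∧
        Pt b'.src U = A U * (U b')⁻¹ ∧
        ∀ V : GaugeField P j SU2, (∀ b, b ≠ b' → V b = U b) → Pt y V = A V * (V b')⁻¹ * B V)) :
    expPoint (c' • adSU2 (Pt y (Function.update U b' (expPoint (c • adSU2 (Pt b'.src U)⁻¹ n) * U b')))⁻¹ n) =
      expPoint (c' • adSU2 (Pt y U)⁻¹ n) := by
  set h : SU2 := expPoint (c • adSU2 (Pt b'.src U)⁻¹ n) with hh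
  have hagree : ∀ b, b ≠ b' → Function.update U b' (h * U b') b = U b := fun b hb => Function.update_of_ne hb _ _
  rcases halt with hi | ⟨B, hB, hA, hfwd⟩ | ⟨A, B, hA, hB, hsrc, hbwd⟩
  · rw [hi]
  · -- forward traversal: `Pt y U′ = Pt b′.src U · (h · U_{b′}) · B U = expPoint(c n̂₀) · Pt y U`
    have e1 : Pt y (Function.update U b' (h * U b')) = expPoint (c • n) * Pt y U := by
      rw [hfwd _ hagree, hA, hB, Function.update_self, hfwd U (fun b _ => rfl), hh]
      exact mul_expPoint_smul_adSU2_inv_mul _ _ _ _ _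
    exact expPoint_smul_adSU2_inv_eq_of_cases c c' n _ _ (Or.inr (Or.inl e1))
  · -- backward traversal: `Pt y U′ = A U · (h · U_{b′})⁻¹ · B U = expPoint(−c n̂₀) · Pt y U`
    have e1 : Pt y (Function.update U b' (h * U b')) = expPoint ((-c) • n) * Pt y U := by
      rw [hbwd _ hagree, hA, hB, Function.update_self, hbwd U (fun b _ => rfl), hh, hsrc]
      exact mul_inv_expPoint_smul_adSU2_mul _ _ _ _ _
    exact expPoint_smul_adSU2_inv_eq_of_cases c c' n _ _ (Or.inr (Or.inr e1))

/-- The same for the INVERSE step `U_{b′} ↦ expPoint(c • Ad n̂₀)⁻¹·U_{b′}` (it is the framed step with amplitude `−c`), as `hstepInv` of §1 wants.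
[cite: Balaban1985Averaging, pp.24-25] -/
theorem framedDir_update_inv_eq (Pt : Site P j → GaugeField P j SU2 → SU2) (n : EuclideanSpace ℝ (Fin 3)) (b' : PBond P j) (y : Site P j)
    (U : GaugeField P j SU2) (c c' : ℝ)
    (halt : (∀ g : SU2, Pt y (Function.update U b' g) = Pt y U) ∨
      (∃ B : GaugeField P j SU2 → SU2, (∀ g : SU2, B (Function.update U b' g) = B U) ∧
        (∀ g : SU2, Pt b'.src (Function.update U b' g) = Pt b'.src U) ∧
        ∀ V : GaugeField P j SU2, (∀ b, b ≠ b' → V b = U b) → Pt y V = Pt b'.src V * V b' * B V) ∨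
      (∃ A B : GaugeField P j SU2 → SU2, (∀ g : SU2, A (Function.update U b' g) = A U) ∧ (∀ g : SU2, B (Function.update U b' g) = B U) ∧
        Pt b'.src U = A U * (U b')⁻¹ ∧
        ∀ V : GaugeField P j SU2, (∀ b, b ≠ b' → V b = U b) → Pt y V = A V * (V b')⁻¹ * B V)) :
    expPoint (c' • adSU2 (Pt y (Function.update U b' ((expPoint (c • adSU2 (Pt b'.src U)⁻¹ n))⁻¹ * U b')))⁻¹ n) =
      expPoint (c' • adSU2 (Pt y U)⁻¹ n) := by
  rw [← CovariantDischargeUniformFluxLetters.expPoint_neg_smul]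
  exact framedDir_update_eq Pt n b' y U (-c) c' halt

/-- **THE OWN-LINK BACKWARD CASE IS A RIGHT TRANSLATION**: if the frame path to the source of `b` ends by traversing `b` itself backwards,
`Pt b.src U = A U · U_b⁻¹` with `A` not reading `U_b`, then the framed step multiplies `U_b` on the RIGHT by the `U_b`-independent
`K(U) = A(U)⁻¹·expPoint(c·n̂₀)·A(U)`: `expPoint(c • Ad_{(A U·U_b⁻¹)⁻¹} n̂₀)·U_b = U_b·(A U)⁻¹·expPoint(c•n̂₀)·A U` — the shape
`measurePreserving_step_of_eq_mul_right` consumes. [cite: Balaban1985Averaging, (10) p.19, pp.24-25] -/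
theorem framedStep_mul_eq_mul_conj (A g : SU2) (c : ℝ) (n : EuclideanSpace ℝ (Fin 3)) :
    expPoint (c • adSU2 (A * g⁻¹)⁻¹ n) * g = g * (A⁻¹ * expPoint (c • n) * A) := by
  rw [expPoint_smul_adSU2', inv_inv]
  group

end PrefixTransport

end Summit.QuantumFields.YangMills.Theorems.CovariantDischargeFramedSweepInvariance

end
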